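import Summits.BirchSwinnertonDyer.Rank1Residual.AdditivePotMult.PotMultRankOneKatoCertificateBSD
import Summits.BirchSwinnertonDyer.Rank1Residual.Additive.KimStructureOfFiveLe
import Summits.BirchSwinnertonDyer.Rank1Residual.Additive.X4RankOneKimResidue
import Summits.BirchSwinnertonDyer.Rank1Residual.Additive.TypeGThreeTowerOfSurj
import HarnessLib

/-!
# X4(M) ∧ `r_an = 1`: the Kurihara `∂`-GAP computed by the Kato/Delbourgo side on the potentially
# MULTIPLICATIVE cell — the (M) twin of `Additive/X4RankOneKimKatoConsistencyGap.lean` over n1011-p07's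
# T-O7KM certificate `MultBranchUnitCertificateAt` (cell `b2b-bsdres`, team n1011, seat p17 gen 2 —
# support for rows T-O7KM (p07) / T-a2r1c; cross-instrument identity for the census)

HONEST FRAMING (cell `b2b-bsdres`, run/shared/lean/b2b/bsd-rank1-residual/, verbatim in every
file): the goal of the cell is to DELETE the COMBINATION-SHAPED residual classes of the
Birch–Swinnerton-Dyer formula for ALL analytic-rank `≤ 1` elliptic curves over `ℚ` — "full BSD
formula for every rank `≤ 1` curve in class `C`" assembled STRICTLY from published theorems — so
that the rank-`≤ 1` remainder becomes exactly the CONSTRUCTION-SHAPED classes, which are TYPED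
(missing-input `Prop`s), NOT attempted. This is not "finishing BSD". Team n1011: prove what is
provable now; shrink each hard class to its core with data; no claim beyond stated classes;
research routes; census output = EVIDENCE / conjecture items, never a Literature fact; RESIDUAL-MAP
marks change only by signed lines. X4 stays CONSTRUCTION-SHAPED; §I O7 / N10 stay as marked; nothing
here is booked. Theorems only (NO definition, NO Literature fact, NO `_holds`); every published input
(named facts `hE73`, `hKato`), every conjecture and every certificate is an explicit hypothesis;
`#print axioms` standard.

COVERAGE (stated first, referee 1 proviso): per pair, `W/ℚ` globally minimal, `ClassX4M W p` (additive at
`p`, `E[p]` irreducible, potentially MULTIPLICATIVE: `ord_p j < 0`), `ρ̄_{E,p}` onto, analytic rank `1`;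
§1: `p ≥ 5`; §2: `p = 3`. HYPOTHESES: Kato 17.4 (3) half-eigenspace divisibility on the `ω`-component of
the multiplicative twist (`hKato` = `Wuthrich2014.kato_halfEigenCharIdeal_dvd_cyclotomicPrime_of_surjective`,
PUBLISHED), `nonempty_modularParametrizationData`, GZK, modularity, p07's ONE-NUMBER certificate
`MultBranchUnitCertificateAt W p` (EVIDENCE), a (B)-datum `Dh` (`LeadingTermClauses W p Dh`; Delbourgo
2002 (B) for (M), `ℓ_p(E) = 1` — no anomalous term), a modular parametrisation datum `D` with
`p ∤ c_D` and the period transfer, ONE non-zero cyclic prime-level Kurihara number (`∂^{(1)} ≠ ∞`,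
EVIDENCE); at `p ≥ 5` Kim's clause (6) AS PRINTED (`hE73`, flag `Kim2026-(6)-cyclic-reading`) with the
Serre tower carried as the binder `htower`, at `p = 3` OUR conjecture `X4SharpThreeKimRankOnePartial`
with the tower = p14's theorem. Kim's Conjecture 1.10 enters ONLY the `_of_tamagawaDefect` corollaries.

## What

p07's T-O7KM identity (p254463 `ClassX4M.schneider_and_padicVal_identity_rankOne_of_katoHalf_of_multCert`,
every odd `p`): `ord_p #Ш(E) + v(Reg_p(E,Dh)) + ord_p ∏c = 1 + 2·ord_p #E(ℚ)_tors`. With Kim's clause (6)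
in rank one (`ord_p #Ш = ∂^{(1)} − ∂^{(∞)}`):

  **`∂^{(1)}(δ̃) − ∂^{(∞)}(δ̃) + v(Reg_p(E,Dh)) + ord_p ∏_ℓ c_ℓ = 1 + 2·ord_p #E(ℚ)_tors`** (§1 at `p ≥ 5`:
  published facts + two certificates ONLY; §2 at `3`: modulo our conjecture), and with Conj. 1.10 at the
  pair **`∂^{(1)}(δ̃) + v(Reg_p(E,Dh)) = 1`** (`p ∤ #tors`).

Universe (EVIDENCE, p17 split of record): O7-ord (M) ∩ X4@3 ∧ r1 = 3 009 rows (2 955 surj ∧ towered; E♭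
split 1 368 · nonsplit 1 587); at `p ≥ 5` the (M) rank-one X4 rows of cc-eng-1's O7 pairs table.
Cross-instrument use: KURX / KUR5 `∂`-gap vs the height lane's `v(Reg_p)` vs p07's certificate — a
`Ш`-free, BSD-free test; at `p ≥ 5` with Conj. 1.10 it tests Conj. 1.10 ALONE.

References: [Kim2022StructureSelmer] Thm. 1.9 (6), Conj. 1.10 (PDF p. 8); [Kato2004Asterisque] Thm. 17.4
(3) (p. 273); [Delbourgo2002] Thm. (B) (p. 40), Hypothesis (p. 39); cell files cells/n1011/OWNERS.md
(T-O7KM, T-a2r1c), HOME/INBOX.md 2026-08-21 07:4xZ (p17).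
-/

noncomputable section

open scoped Classical MatrixGroups ModularForm NumberField

namespace Summit.BirchSwinnertonDyer.Rank1Residual.AdditivePotMult

open CongruenceSubgroup WeierstrassCurve NumberField Literature.NumberTheory.EllipticCurves
  Literature.NumberTheory.EllipticCurves.ModularForms
  Literature.NumberTheory.EllipticCurves.Rank1Residual
  Literature.NumberTheory.EllipticCurves.Rank1Residual.Typed
  Literature.NumberTheory.EllipticCurves.Delbourgo2002
  Literature.NumberTheory.GaloisRepresentations Summit.BirchSwinnertonDyer.Rank1Residual.Additive
  Summit.BirchSwinnertonDyer.Rank1Residual.X1.MuLambda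
  Summit.BirchSwinnertonDyer.Rank1Residual.X1.RankOneParitySqueeze
  IsDedekindDomain

/-! ## §1 `p ≥ 5`: NO conjecture -/

section FiveLe

variable {W : WeierstrassCurve ℚ} [W.IsElliptic] [W.IsGloballyMinimal] {p : ℕ} [hp : Fact p.Prime]

/-- **X4(M), `p ≥ 5`, surj(p), `r_an = 1`, p07's certificate, (B)-datum, ONE non-zero prime-level Kurihara
number: `∂^{(1)}(δ̃) − ∂^{(∞)}(δ̃) + v(Reg_p(E,Dh)) + ord_p ∏c = 1 + 2·ord_p #E(ℚ)_tors`** — modulo the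
PUBLISHED facts `hE73`, `hKato`, GZK, modularity and the two certificates; NO conjecture. Per pair;
nothing booked. [cite: Kim2022StructureSelmer, Thm. 1.9 (6) (PDF p. 8)] [cite: Kato2004Asterisque, Thm. 17.4 (3) (p. 273)]
[cite: Delbourgo2002, Theorem (B) (p. 40)] -/
theorem ClassX4M.kuriharaGap_identity_rankOne_of_kim2026_of_katoHalf_of_multCert_of_five_le
    (hE73 : Kim2026.kuriharaPartial_vanishingOrder_eq_padicValNat_sha_add_partialInfty_of_maninConstant)
    (hKato : Wuthrich2014.kato_halfEigenCharIdeal_dvd_cyclotomicPrime_of_surjective)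
    (hmodD : nonempty_modularParametrizationData)
    (hGZK : rank_eq_analyticRank_of_analyticRank_le_one) (hmod : hasEntireLFunction_rat)
    (hX : ClassX4M W p) (hp5 : 5 ≤ p) (hsurj : Surj W p)
    (htower : ∀ n : ℕ, W.HasSurjectiveModNGaloisRep (p ^ n : ℕ))
    (hr : W.analyticRank = 1) (hcert : MultBranchUnitCertificateAt W p)
    {Dh : PAdicHeightData W p} (hB : LeadingTermClauses W p Dh)
    {N : ℕ} [NeZero N] (D : ModularParametrizationData W N) (hc : ¬ (p : ℤ) ∣ D.maninConstant)
    (hper : ∃ u : ℚ, ‖(u : ℚ_[p])‖ = 1 ∧ W.realPeriodRat = u * plusPeriod D.f)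
    (hne : kuriharaPartial W p D.f 1 ≠ ⊤) :
    ∃ m d : ℕ, kuriharaPartial W p D.f 1 = m ∧ kuriharaPartialInfty W p D.f = d ∧
      (m : ℤ) - d + (padicRegulator Dh).valuation + padicValNat p W.tamagawaProduct =
        1 + 2 * padicValNat p W.torsionOrder := by
  have hr1 : W.analyticRank ≤ 1 := by rw [hr]
  have hL : W.entireLFunction 1 = 0 := by
    by_contra hne'
    have h0 := (W.analyticRank_eq_zero_iff_holds (hmod W)).mpr hne'
    omega
  have hfin : Finite W.sha := (hGZK W hr1).2
  have hid := padicValNat_shaOrder_add_partialInfty_eq_of_kimRankOnePartialAt W p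
    (kimRankOnePartialAt_of_kim2026_of_five_le W p hE73 hp5) hsurj htower hL hr hfin D hc hper hne
  obtain ⟨-, hidK⟩ :=
    hX.schneider_and_padicVal_identity_rankOne_of_katoHalf_of_multCert hKato hmodD hGZK hsurj hr hcert hB
  obtain ⟨d, hd⟩ := ENat.ne_top_iff_exists.mp
    (kuriharaPartialInfty_ne_top_of_kuriharaPartial_one_ne_top W p D.f hne)
  refine ⟨padicValNat p W.shaOrder + d, d, ?_, hd.symm, ?_⟩
  · rw [← hid, ← hd]
    push_cast
    rfl
  · rw [Nat.cast_add]
    linarith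

/-- **With Kim's Conjecture 1.10 at the pair**, `p ≥ 5`, X4(M): **`∂^{(1)}(δ̃) + v(Reg_p(E,Dh)) = 1`**
(`p ∤ #E(ℚ)_tors` as `E[p]` is irreducible). A falsification test of Conj. 1.10 ALONE on the (M) rows
with p07's certificate. Per pair; nothing booked. [cite: Kim2022StructureSelmer, Thm. 1.9 (6), Conj. 1.10 (PDF p. 8)]
[cite: Kato2004Asterisque, Thm. 17.4 (3) (p. 273)] [cite: Delbourgo2002, Theorem (B) (p. 40)] -/
theorem ClassX4M.kuriharaPartial_one_add_regulator_eq_one_of_kim2026_of_tamagawaDefect_of_multCert_of_five_le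
    (hE73 : Kim2026.kuriharaPartial_vanishingOrder_eq_padicValNat_sha_add_partialInfty_of_maninConstant)
    (hKato : Wuthrich2014.kato_halfEigenCharIdeal_dvd_cyclotomicPrime_of_surjective)
    (hmodD : nonempty_modularParametrizationData)
    (hGZK : rank_eq_analyticRank_of_analyticRank_le_one) (hmod : hasEntireLFunction_rat)
    (hX : ClassX4M W p) (hp5 : 5 ≤ p) (hsurj : Surj W p)
    (htower : ∀ n : ℕ, W.HasSurjectiveModNGaloisRep (p ^ n : ℕ))
    (hr : W.analyticRank = 1) (hcert : MultBranchUnitCertificateAt W p)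
    {Dh : PAdicHeightData W p} (hB : LeadingTermClauses W p Dh)
    {N : ℕ} [NeZero N] (D : ModularParametrizationData W N) (hc : ¬ (p : ℤ) ∣ D.maninConstant)
    (hper : ∃ u : ℚ, ‖(u : ℚ_[p])‖ = 1 ∧ W.realPeriodRat = u * plusPeriod D.f)
    (hne : kuriharaPartial W p D.f 1 ≠ ⊤) (hT : X4.KimTamagawaDefectAt W p D.f) :
    ∃ m : ℕ, kuriharaPartial W p D.f 1 = m ∧ (m : ℤ) + (padicRegulator Dh).valuation = 1 := by
  obtain ⟨m, d, hm, hd, hid⟩ :=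
    hX.kuriharaGap_identity_rankOne_of_kim2026_of_katoHalf_of_multCert_of_five_le hE73 hKato hmodD hGZK
      hmod hp5 hsurj htower hr hcert hB D hc hper hne
  have htors0 : padicValNat p W.torsionOrder = 0 :=
    padicValNat_torsionOrder_eq_zero_of_irreducible W p hX.classX4.2.2
  unfold X4.KimTamagawaDefectAt at hT
  have hdT : (d : ℕ∞) = (padicValNat p W.tamagawaProduct : ℕ∞) := hd.symm.trans hT
  have hdT' : d = padicValNat p W.tamagawaProduct := by exact_mod_cast hdT
  refine ⟨m, hm, ?_⟩
  rw [htors0, hdT'] at hid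
  simp only [Nat.cast_zero, mul_zero, add_zero] at hid
  linarith

end FiveLe

/-! ## §2 `p = 3`: modulo our `∂`-clause conjecture (tower = p14's theorem) -/

section Three

variable {W : WeierstrassCurve ℚ} [W.IsElliptic] [W.IsGloballyMinimal] [hp : Fact (Nat.Prime 3)]

/-- **X4(M)@3, surj(3), `r_an = 1`, p07's certificate at `3`, (B)-datum, ONE non-zero prime-level Kurihara
number: `∂^{(1)}(δ̃) − ∂^{(∞)}(δ̃) + v(Reg₃(E,Dh)) + ord₃ ∏c = 1 + 2·ord₃ #E(ℚ)_tors`** — modulo OUR conjecture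
`X4SharpThreeKimRankOnePartial` + Kato 17.4 (3) + GZK + modularity + the certificates; NO Conj. 1.10.
Per pair; nothing booked. [cite: Kim2022StructureSelmer, Thm. 1.9 (6) (PDF p. 8)] [cite: Kato2004Asterisque, Thm. 17.4 (3) (p. 273)]
[cite: Delbourgo2002, Theorem (B) (p. 40)] -/
theorem ClassX4M.kuriharaGap_identity_three_rankOne_of_kimPartial_of_katoHalf_of_multCert
    (h3 : X4SharpThreeKimRankOnePartial)
    (hKato : Wuthrich2014.kato_halfEigenCharIdeal_dvd_cyclotomicPrime_of_surjective)
    (hmodD : nonempty_modularParametrizationData)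
    (hGZK : rank_eq_analyticRank_of_analyticRank_le_one) (hmod : hasEntireLFunction_rat)
    (hX : ClassX4M W 3) (hsurj : Surj W 3) (hr : W.analyticRank = 1)
    (hcert : MultBranchUnitCertificateAt W 3)
    {Dh : PAdicHeightData W 3} (hB : LeadingTermClauses W 3 Dh)
    {N : ℕ} [NeZero N] (D : ModularParametrizationData W N) (hc : ¬ (3 : ℤ) ∣ D.maninConstant)
    (hper : ∃ u : ℚ, ‖(u : ℚ_[3])‖ = 1 ∧ W.realPeriodRat = u * plusPeriod D.f)
    (hne : kuriharaPartial W 3 D.f 1 ≠ ⊤) :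
    ∃ m d : ℕ, kuriharaPartial W 3 D.f 1 = m ∧ kuriharaPartialInfty W 3 D.f = d ∧
      (m : ℤ) - d + (padicRegulator Dh).valuation + padicValNat 3 W.tamagawaProduct =
        1 + 2 * padicValNat 3 W.torsionOrder := by
  have hr1 : W.analyticRank ≤ 1 := by rw [hr]
  have hL : W.entireLFunction 1 = 0 := by
    by_contra hne'
    have h0 := (W.analyticRank_eq_zero_iff_holds (hmod W)).mpr hne'
    omega
  have hfin : Finite W.sha := (hGZK W hr1).2
  have hid := padicValNat_shaOrder_add_partialInfty_eq_of_kimRankOnePartialAt W 3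
    (kimRankOnePartialAt_three_of_classX4 W h3 hX.classX4) hsurj
    (ClassX4.towerSurj_three_of_surj_of_typeG_or_potMult hX.classX4 (Or.inr hX.potMult.2) hsurj) hL hr
    hfin D (by exact_mod_cast hc) hper hne
  obtain ⟨-, hidK⟩ :=
    hX.schneider_and_padicVal_identity_rankOne_of_katoHalf_of_multCert hKato hmodD hGZK hsurj hr hcert hB
  obtain ⟨d, hd⟩ := ENat.ne_top_iff_exists.mp
    (kuriharaPartialInfty_ne_top_of_kuriharaPartial_one_ne_top W 3 D.f hne)
  refine ⟨padicValNat 3 W.shaOrder + d, d, ?_, hd.symm, ?_⟩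
  · rw [← hid, ← hd]
    push_cast
    rfl
  · rw [Nat.cast_add]
    linarith

/-- **X4(M)@3 with Conj. 1.10 at the pair: `∂^{(1)}(δ̃) + v(Reg₃(E,Dh)) = 1`** — modulo
{`X4SharpThreeKimRankOnePartial`, Conj. 1.10} ∧ Kato 17.4 (3) ∧ the certificates. The (M)@3 twin of
`ClassX4Gord.kuriharaPartial_one_add_regulator_eq_one_three_of_nonAnomalous` (2 955 surj ∧ towered (M)@3
rank-one rows; no anomalous term on (M)). Per pair; nothing booked.
[cite: Kim2022StructureSelmer, Thm. 1.9 (6), Conj. 1.10 (PDF p. 8)] [cite: Kato2004Asterisque, Thm. 17.4 (3) (p. 273)]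
[cite: Delbourgo2002, Theorem (B) (p. 40)] -/
theorem ClassX4M.kuriharaPartial_one_add_regulator_eq_one_three_of_kimPartial_of_tamagawaDefect_of_multCert
    (h3 : X4SharpThreeKimRankOnePartial)
    (hKato : Wuthrich2014.kato_halfEigenCharIdeal_dvd_cyclotomicPrime_of_surjective)
    (hmodD : nonempty_modularParametrizationData)
    (hGZK : rank_eq_analyticRank_of_analyticRank_le_one) (hmod : hasEntireLFunction_rat)
    (hX : ClassX4M W 3) (hsurj : Surj W 3) (hr : W.analyticRank = 1)
    (hcert : MultBranchUnitCertificateAt W 3)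
    {Dh : PAdicHeightData W 3} (hB : LeadingTermClauses W 3 Dh)
    {N : ℕ} [NeZero N] (D : ModularParametrizationData W N) (hc : ¬ (3 : ℤ) ∣ D.maninConstant)
    (hper : ∃ u : ℚ, ‖(u : ℚ_[3])‖ = 1 ∧ W.realPeriodRat = u * plusPeriod D.f)
    (hne : kuriharaPartial W 3 D.f 1 ≠ ⊤) (hT : X4.KimTamagawaDefectAt W 3 D.f) :
    ∃ m : ℕ, kuriharaPartial W 3 D.f 1 = m ∧ (m : ℤ) + (padicRegulator Dh).valuation = 1 := by
  obtain ⟨m, d, hm, hd, hid⟩ :=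
    hX.kuriharaGap_identity_three_rankOne_of_kimPartial_of_katoHalf_of_multCert h3 hKato hmodD hGZK hmod
      hsurj hr hcert hB D hc hper hne
  have htors0 : padicValNat 3 W.torsionOrder = 0 :=
    padicValNat_torsionOrder_eq_zero_of_irreducible W 3 hX.classX4.2.2
  unfold X4.KimTamagawaDefectAt at hT
  have hdT : (d : ℕ∞) = (padicValNat 3 W.tamagawaProduct : ℕ∞) := hd.symm.trans hT
  have hdT' : d = padicValNat 3 W.tamagawaProduct := by exact_mod_cast hdT
  refine ⟨m, hm, ?_⟩
  rw [htors0, hdT'] at hid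
  simp only [Nat.cast_zero, mul_zero, add_zero] at hid
  linarith

end Three

end Summit.BirchSwinnertonDyer.Rank1Residual.AdditivePotMult

end
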